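import Summits.Ventures.DiscreteObjects.PP12.FlagOrbitMatrix
import Summits.Ventures.DiscreteObjects.PP12.FlagOrbitIndexSets

/-!
# The generic flag-cell orbit matrix: the columns ARE the non-trivial point orbits, and the c-line rows (kernel; Step B of the generic FlagOrbitReduction)
Framing: lottery ticket; floor = certified bounds/negative ranges.

Cell pub-namedobj (venture DiscreteObjects), target (M), designs gen 15; generic sibling of `FlagSevenColOrbits` (`f = 7`). Setting as in
`FlagOrbitIndexSets` (order 12, flag type, `σ³ = 1`, `f = 13 − 3ρ` fixed points, class representatives `repF s`, `s : Fin ρ`). For the column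
index type `FCol ρ = Fin ρ ⊕ (Fin ρ × Fin 12) ⊕ (Fin (12 − 3ρ) × Fin 4)` of `IsFlagOrbitMatrix` (p-typed in `FlagOrbitMatrix`):
* `colOrbitR` — column `c` ↦ its point orbit (`Z_t`; the triangle `orb3 x_{s,i}`, `x_{s,i}` the `i`-th point `≠ c` of `repF s`; the T-point
  orbit `(j,t)` on `m_j`); `colOrbitR_mem_orbits3`, `colOrbitR_injective`, `exists_colOrbitR_eq`: this is a BIJECTION onto the non-trivial point
  orbits, so `Σ_{c : FCol ρ}` is `Σ_{S ∈ orbits3 σ}` (`sum_colOrbitR`);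
* `pointRepR`, `colOrbitR_eq_orb3_pointRepR` — a generating point of each column orbit;
* `card_colOrbitR_filter_repF` — **the c-line rows of the matrix**: `|colOrbitR c ∩ repF s| = gammaEntry s c` (a c-line meets `l` and the
  `m_j` only in `c`, carries one vertex of each triangle of its class and no point of a triangle of another class).
No `sorry`, no new axioms.
-/

namespace Summit.Ventures.DiscreteObjects.PP12

open Configuration Finset
open scoped Classical

namespace Collineation

variable {P L : Type*} [Membership P L] [ProjectivePlane P L] [Fintype P] [Fintype L] (σ : Collineation P L)

section Flag

variable {l : L} {c : P}

section Data

variable (hl : σ.onLines l = l) (hc : σ.onPoints c = c) (hcl : c ∈ l)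
  (hP : ∀ p : P, σ.onPoints p = p → p ∈ l) (hL : ∀ m : L, σ.onLines m = m → c ∈ m) (h12 : ProjectivePlane.order P L = 12)
  (hq : σ.onPoints ^ 3 = 1) {ρ : ℕ} (hf : fixedCard σ.onPoints = 13 - 3 * ρ)

/-- **The point orbit of a column** of the generic flag-cell orbit matrix. -/
noncomputable def colOrbitR : FCol ρ → Finset P
  | Sum.inl t => (σ.eZR hl hP h12 hq hf t).1
  | Sum.inr (Sum.inl (s, i)) => orb3 σ.onPoints (σ.eTriR hc hL h12 hq hf s i).1
  | Sum.inr (Sum.inr (j, t)) => (σ.eOrbOn hc hcl hP hL h12 hq (σ.eFixLR hl hc hf j) t).1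

/-- Every column orbit is a non-trivial point orbit. -/
theorem colOrbitR_mem_orbits3 (c₀ : FCol ρ) : σ.colOrbitR hl hc hcl hP hL h12 hq hf c₀ ∈ σ.orbits3 := by
  unfold orbits3
  rcases c₀ with t | ⟨s, i⟩ | ⟨j, t⟩
  · obtain ⟨z, hz, hzeq⟩ := mem_image.1 (σ.eZR hl hP h12 hq hf t).2
    rw [mem_filter] at hz
    exact mem_image.2 ⟨z, mem_filter.2 ⟨mem_univ _, hz.2.2⟩, hzeq⟩
  · have hxX := σ.exterior_of_triIdxR hc hL h12 hq hf s (σ.eTriR hc hL h12 hq hf s i)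
    exact mem_image.2 ⟨_, mem_filter.2 ⟨mem_univ _, σ.not_fixed_of_exterior_flag hl hP hxX⟩, rfl⟩
  · set m := σ.eFixLR hl hc hf j with hm
    obtain ⟨w, hw, hweq⟩ := mem_image.1 (σ.eOrbOn hc hcl hP hL h12 hq m t).2
    rw [mem_filter] at hw
    have hwf : σ.onPoints w ≠ w := fun e => hw.2.2 ((Nondegenerate.eq_or_eq hw.2.1 (hL m.1 m.2.1) (hP w e) hcl).resolve_right m.2.2)
    exact mem_image.2 ⟨w, mem_filter.2 ⟨mem_univ _, hwf⟩, hweq⟩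

/-- **The column indexing is injective.** -/
theorem colOrbitR_injective : Function.Injective (σ.colOrbitR hl hc hcl hP hL h12 hq hf) := by
  intro c₁ c₂ h
  have zfacts : ∀ t : Fin ρ, ∀ p ∈ (σ.eZR hl hP h12 hq hf t).1, p ∈ l ∧ σ.onPoints p ≠ p :=
    fun t p hp => σ.zOrbit_sub hl (σ.eZR hl hP h12 hq hf t).2 hp
  have trifacts : ∀ (s : Fin ρ) (i : Fin 12), ∀ p ∈ orb3 σ.onPoints (σ.eTriR hc hL h12 hq hf s i).1,
      ∀ m : L, σ.onLines m = m → p ∉ m :=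
    fun s i p hp => σ.exterior_of_mem_orb3 (σ.exterior_of_triIdxR hc hL h12 hq hf s (σ.eTriR hc hL h12 hq hf s i)) hp
  have tfacts : ∀ (j : Fin (12 - 3 * ρ)) (t : Fin 4), ∀ p ∈ (σ.eOrbOn hc hcl hP hL h12 hq (σ.eFixLR hl hc hf j) t).1,
      p ∈ (σ.eFixLR hl hc hf j).1 ∧ p ≠ c ∧ σ.onPoints p ≠ p :=
    fun j t p hp => σ.orbOn_sub hc hcl hP hL (σ.eFixLR hl hc hf j).2.1 (σ.eFixLR hl hc hf j).2.2 (σ.eOrbOn hc hcl hP hL h12 hq _ t).2 hp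
  have zne : ∀ t : Fin ρ, ((σ.eZR hl hP h12 hq hf t).1 : Finset P).Nonempty := fun t => by
    obtain ⟨z, -, hzeq⟩ := mem_image.1 (σ.eZR hl hP h12 hq hf t).2
    exact ⟨z, by rw [← hzeq]; exact self_mem_orb3 _ _⟩
  have tne : ∀ (j : Fin (12 - 3 * ρ)) (t : Fin 4), ((σ.eOrbOn hc hcl hP hL h12 hq (σ.eFixLR hl hc hf j) t).1 : Finset P).Nonempty :=
    fun j t => by
    obtain ⟨w, -, hweq⟩ := mem_image.1 (σ.eOrbOn hc hcl hP hL h12 hq (σ.eFixLR hl hc hf j) t).2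
    exact ⟨w, by rw [← hweq]; exact self_mem_orb3 _ _⟩
  rcases c₁ with t | ⟨s, i⟩ | ⟨j, t⟩ <;> rcases c₂ with t' | ⟨s', i'⟩ | ⟨j', t'⟩ <;>
    simp only [colOrbitR] at h
  · exact congrArg Sum.inl ((σ.eZR hl hP h12 hq hf).injective (Subtype.ext h))
  · exfalso
    obtain ⟨p, hp⟩ := zne t
    have h1 := (zfacts t p hp).1
    rw [h] at hp
    exact trifacts s' i' p hp l hl h1
  · exfalso
    obtain ⟨p, hp⟩ := zne t
    have h1 := (zfacts t p hp).1
    rw [h] at hp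
    obtain ⟨hpm, hpc, -⟩ := tfacts j' t' p hp
    exact hpc ((Nondegenerate.eq_or_eq hpm (hL _ (σ.eFixLR hl hc hf j').2.1) h1 hcl).resolve_right (σ.eFixLR hl hc hf j').2.2)
  · exfalso
    obtain ⟨p, hp⟩ := zne t'
    have h1 := (zfacts t' p hp).1
    rw [← h] at hp
    exact trifacts s i p hp l hl h1
  · -- tri / tri
    set x := σ.eTriR hc hL h12 hq hf s i with hx
    set x' := σ.eTriR hc hL h12 hq hf s' i' with hx'
    have hx'x : x'.1 ∈ orb3 σ.onPoints x.1 := by rw [h]; exact self_mem_orb3 _ _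
    by_cases hss : s = s'
    · subst hss
      have heq : x'.1 = x.1 :=
        σ.vertex_eq_of_mem_orb3 hc hq (σ.repF_spec hc hL h12 hq hf s).1 (σ.repF_spec hc hL h12 hq hf s).2 x'.2.1 x.2.1 hx'x
      have : i' = i := (σ.eTriR hc hL h12 hq hf s).injective (Subtype.ext heq)
      rw [this]
    · exfalso
      have hxx' : x.1 ∈ orb3 σ.onPoints x'.1 := by rw [orb3_eq_of_mem σ.onPoints hq hx'x]; exact self_mem_orb3 _ _
      exact σ.triIdxR_class_unique hc hL h12 hq hf hss x' hxx' x.2.1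
  · exfalso
    obtain ⟨p, hp⟩ := tne j' t'
    obtain ⟨hpm, -, -⟩ := tfacts j' t' p hp
    rw [← h] at hp
    exact trifacts s i p hp _ (σ.eFixLR hl hc hf j').2.1 hpm
  · exfalso
    obtain ⟨p, hp⟩ := zne t'
    have h1 := (zfacts t' p hp).1
    rw [← h] at hp
    obtain ⟨hpm, hpc, -⟩ := tfacts j t p hp
    exact hpc ((Nondegenerate.eq_or_eq hpm (hL _ (σ.eFixLR hl hc hf j).2.1) h1 hcl).resolve_right (σ.eFixLR hl hc hf j).2.2)
  · exfalso
    obtain ⟨p, hp⟩ := tne j t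
    obtain ⟨hpm, -, -⟩ := tfacts j t p hp
    rw [h] at hp
    exact trifacts s' i' p hp _ (σ.eFixLR hl hc hf j).2.1 hpm
  · -- tpt / tpt
    obtain ⟨p, hp⟩ := tne j t
    obtain ⟨hpm, hpc, -⟩ := tfacts j t p hp
    have hp' := hp; rw [h] at hp'
    obtain ⟨hpm', -, -⟩ := tfacts j' t' p hp'
    have hjj : j = j' := by
      by_contra hne
      have hmm : (σ.eFixLR hl hc hf j).1 ≠ (σ.eFixLR hl hc hf j').1 := fun e => hne ((σ.eFixLR hl hc hf).injective (Subtype.ext e))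
      exact hpc ((Nondegenerate.eq_or_eq hpm (hL _ (σ.eFixLR hl hc hf j).2.1) hpm' (hL _ (σ.eFixLR hl hc hf j').2.1)).resolve_right hmm)
    subst hjj
    have : t = t' := (σ.eOrbOn hc hcl hP hL h12 hq (σ.eFixLR hl hc hf j)).injective (Subtype.ext h)
    rw [this]

/-- **The column indexing is surjective** onto the non-trivial point orbits. -/
theorem exists_colOrbitR_eq {S : Finset P} (hS : S ∈ σ.orbits3) : ∃ c₀ : FCol ρ, σ.colOrbitR hl hc hcl hP hL h12 hq hf c₀ = S := by
  unfold orbits3 at hS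
  obtain ⟨p, hp, rfl⟩ := mem_image.1 hS
  rw [mem_filter] at hp
  obtain ⟨-, hpf⟩ := hp
  by_cases hpl : p ∈ l
  · have hmem : orb3 σ.onPoints p ∈ (univ.filter fun q : P => q ∈ l ∧ σ.onPoints q ≠ q).image (orb3 σ.onPoints) :=
      σ.lpointOrbit_mem hpl hpf
    refine ⟨Sum.inl ((σ.eZR hl hP h12 hq hf).symm ⟨_, hmem⟩), ?_⟩
    simp only [colOrbitR, Equiv.apply_symm_apply]
  · by_cases hfix : ∃ m : L, σ.onLines m = m ∧ p ∈ m
    · obtain ⟨m, hm, hpm⟩ := hfix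
      have hml : m ≠ l := fun e => hpl (e ▸ hpm)
      have hpc : p ≠ c := fun e => hpf (by rw [e, hc])
      have hmem : orb3 σ.onPoints p ∈ (univ.filter fun q : P => q ∈ m ∧ q ≠ c).image (orb3 σ.onPoints) :=
        mem_image.2 ⟨p, mem_filter.2 ⟨mem_univ _, hpm, hpc⟩, rfl⟩
      set j := (σ.eFixLR hl hc hf).symm ⟨m, hm, hml⟩ with hj
      have hmj : (σ.eFixLR hl hc hf j) = ⟨m, hm, hml⟩ := by rw [hj, Equiv.apply_symm_apply]
      refine ⟨Sum.inr (Sum.inr (j, (σ.eOrbOn hc hcl hP hL h12 hq (σ.eFixLR hl hc hf j)).symm ⟨_, by rw [hmj]; exact hmem⟩)), ?_⟩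
      simp only [colOrbitR, Equiv.apply_symm_apply]
    · push Not at hfix
      have hpX : ∀ m : L, σ.onLines m = m → p ∉ m := fun m hm hpm => hfix m hm hpm
      obtain ⟨s, x, hxp, hxu⟩ := σ.exists_class_of_exterior hl hc hcl hL h12 hq hf hpX
      have hxX := σ.exterior_of_mem_orb3 hpX hxp
      have hxc : x ≠ c := fun e => hxX l hl (e ▸ hcl)
      refine ⟨Sum.inr (Sum.inl (s, (σ.eTriR hc hL h12 hq hf s).symm ⟨x, hxu, hxc⟩)), ?_⟩
      simp only [colOrbitR, Equiv.apply_symm_apply]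
      exact orb3_eq_of_mem σ.onPoints hq hxp

/-- `Σ_{c : FCol ρ} g (colOrbitR c) = Σ_{S ∈ orbits3 σ} g S`. -/
theorem sum_colOrbitR (g : Finset P → ℕ) : ∑ c₀ : FCol ρ, g (σ.colOrbitR hl hc hcl hP hL h12 hq hf c₀) = ∑ S ∈ σ.orbits3, g S := by
  refine Finset.sum_bij (fun c₀ _ => σ.colOrbitR hl hc hcl hP hL h12 hq hf c₀) (fun c₀ _ => σ.colOrbitR_mem_orbits3 hl hc hcl hP hL h12 hq hf c₀)
    (fun c₁ _ c₂ _ h => σ.colOrbitR_injective hl hc hcl hP hL h12 hq hf h) (fun S hS => ?_) (fun c₀ _ => rfl)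
  obtain ⟨c₀, hc₀⟩ := σ.exists_colOrbitR_eq hl hc hcl hP hL h12 hq hf hS
  exact ⟨c₀, mem_univ _, hc₀⟩

/-- A point generating the column orbit. -/
noncomputable def pointRepR : FCol ρ → P
  | Sum.inl t => (mem_image.1 (σ.eZR hl hP h12 hq hf t).2).choose
  | Sum.inr (Sum.inl (s, i)) => (σ.eTriR hc hL h12 hq hf s i).1
  | Sum.inr (Sum.inr (j, t)) => (mem_image.1 (σ.eOrbOn hc hcl hP hL h12 hq (σ.eFixLR hl hc hf j) t).2).choose

/-- `colOrbitR c = orb3 (pointRepR c)` and `pointRepR c` is not fixed. -/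
theorem colOrbitR_eq_orb3_pointRepR (c₀ : FCol ρ) :
    σ.colOrbitR hl hc hcl hP hL h12 hq hf c₀ = orb3 σ.onPoints (σ.pointRepR hl hc hcl hP hL h12 hq hf c₀) ∧
      σ.onPoints (σ.pointRepR hl hc hcl hP hL h12 hq hf c₀) ≠ σ.pointRepR hl hc hcl hP hL h12 hq hf c₀ := by
  rcases c₀ with t | ⟨s, i⟩ | ⟨j, t⟩
  · have hspec := (mem_image.1 (σ.eZR hl hP h12 hq hf t).2).choose_spec
    rw [mem_filter] at hspec
    exact ⟨hspec.2.symm, hspec.1.2.2⟩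
  · exact ⟨rfl, σ.not_fixed_of_exterior_flag hl hP (σ.exterior_of_triIdxR hc hL h12 hq hf s (σ.eTriR hc hL h12 hq hf s i))⟩
  · set m := σ.eFixLR hl hc hf j with hm
    have hspec := (mem_image.1 (σ.eOrbOn hc hcl hP hL h12 hq m t).2).choose_spec
    rw [mem_filter] at hspec
    refine ⟨hspec.2.symm, fun e => hspec.1.2.2 ?_⟩
    exact (Nondegenerate.eq_or_eq hspec.1.2.1 (hL m.1 m.2.1) (hP _ e) hcl).resolve_right m.2.2

/-- Facts about the representative points: `pointRepR (Z_t) ∈ l` and `l` is the only fixed line through it; `pointRepR (triangle)` is exterior;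
`pointRepR (j,t) ∈ m_j` and `m_j` is the only fixed line through it. -/
theorem pointRepR_facts :
    (∀ t : Fin ρ, σ.pointRepR hl hc hcl hP hL h12 hq hf (Sum.inl t) ∈ l ∧
      ∀ m : L, σ.onLines m = m → σ.pointRepR hl hc hcl hP hL h12 hq hf (Sum.inl t) ∈ m → m = l) ∧
    (∀ (s : Fin ρ) (i : Fin 12), ∀ m : L, σ.onLines m = m → σ.pointRepR hl hc hcl hP hL h12 hq hf (Sum.inr (Sum.inl (s, i))) ∉ m) ∧
    (∀ (j : Fin (12 - 3 * ρ)) (t : Fin 4), σ.pointRepR hl hc hcl hP hL h12 hq hf (Sum.inr (Sum.inr (j, t))) ∈ (σ.eFixLR hl hc hf j).1 ∧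
      ∀ m : L, σ.onLines m = m → σ.pointRepR hl hc hcl hP hL h12 hq hf (Sum.inr (Sum.inr (j, t))) ∈ m → m = (σ.eFixLR hl hc hf j).1) := by
  refine ⟨fun t => ?_, fun s i => σ.exterior_of_triIdxR hc hL h12 hq hf s (σ.eTriR hc hL h12 hq hf s i), fun j t => ?_⟩
  · have hrep : σ.pointRepR hl hc hcl hP hL h12 hq hf (Sum.inl t) = (mem_image.1 (σ.eZR hl hP h12 hq hf t).2).choose := rfl
    have hspec := (mem_image.1 (σ.eZR hl hP h12 hq hf t).2).choose_spec
    rw [mem_filter, ← hrep] at hspec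
    refine ⟨hspec.1.2.1, fun m hm hzm => ?_⟩
    by_contra hml
    have hzc : σ.pointRepR hl hc hcl hP hL h12 hq hf (Sum.inl t) = c :=
      (Nondegenerate.eq_or_eq hzm (hL m hm) hspec.1.2.1 hcl).resolve_right hml
    exact hspec.1.2.2 (by rw [hzc, hc])
  · have hrep : σ.pointRepR hl hc hcl hP hL h12 hq hf (Sum.inr (Sum.inr (j, t)))
        = (mem_image.1 (σ.eOrbOn hc hcl hP hL h12 hq (σ.eFixLR hl hc hf j) t).2).choose := rfl
    have hspec := (mem_image.1 (σ.eOrbOn hc hcl hP hL h12 hq (σ.eFixLR hl hc hf j) t).2).choose_spec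
    rw [mem_filter, ← hrep] at hspec
    refine ⟨hspec.1.2.1, fun m hm hwm' => ?_⟩
    by_contra hne
    exact hspec.1.2.2 ((Nondegenerate.eq_or_eq hwm' (hL m hm) hspec.1.2.1 (hL _ (σ.eFixLR hl hc hf j).2.1)).resolve_right hne)

/-! ### The c-line rows -/

/-- **The c-line rows of the orbit matrix:** `|colOrbitR c ∩ repF s| = gammaEntry s c` — the orbits on `l` and on the `m_j` meet a c-line
only in the fixed point `c` (which is in no non-trivial orbit), a c-line of class `s` carries exactly one vertex of each triangle of class `s`
(`card_orb3_inter_cline_le_one`) and no point of a triangle of another class (`triIdxR_class_unique`). -/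
theorem card_colOrbitR_filter_repF (s : Fin ρ) (c₀ : FCol ρ) :
    ((σ.colOrbitR hl hc hcl hP hL h12 hq hf c₀).filter fun q => q ∈ σ.repF hc hL h12 hq hf s).card = FlagOrbit.gammaEntry s c₀ := by
  have hcs := σ.repF_spec hc hL h12 hq hf s
  have hul : σ.repF hc hL h12 hq hf s ≠ l := fun e => hcs.2 (by rw [e, hl])
  rcases c₀ with t | ⟨s', i'⟩ | ⟨j, t⟩
  · -- Z_t
    obtain ⟨z, hz, hzeq⟩ := mem_image.1 (σ.eZR hl hP h12 hq hf t).2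
    rw [mem_filter] at hz
    have hmeet : meetPt c (σ.repF hc hL h12 hq hf s) l = c := (meetPt_eq c hul hcs.1 hcl).symm
    change (((σ.eZR hl hP h12 hq hf t).1 : Finset P).filter fun q => q ∈ σ.repF hc hL h12 hq hf s).card = 0
    rw [← hzeq, σ.card_filter_orb3_on_fixedLine (c := c) hl hul hz.2.1, hmeet, if_neg (σ.not_mem_orb3_of_fixed hc hz.2.2)]
  · -- triangle (s', i')
    set x' := σ.eTriR hc hL h12 hq hf s' i' with hx'
    change ((orb3 σ.onPoints x'.1).filter fun q => q ∈ σ.repF hc hL h12 hq hf s).card = (if s' = s then 1 else 0)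
    have hle := σ.card_orb3_inter_cline_le_one hc hq hcs.1 hcs.2 x'.1
    by_cases hss : s' = s
    · subst hss
      rw [if_pos rfl]
      have hpos : 0 < ((orb3 σ.onPoints x'.1).filter fun q => q ∈ σ.repF hc hL h12 hq hf s').card :=
        card_pos.2 ⟨x'.1, mem_filter.2 ⟨self_mem_orb3 _ _, x'.2.1⟩⟩
      omega
    · rw [if_neg hss, card_eq_zero, filter_eq_empty_iff]
      intro p hp hpu
      exact σ.triIdxR_class_unique hc hL h12 hq hf (fun e => hss e.symm) x' hp hpu
  · -- T-point orbit (j, t)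
    set m := σ.eFixLR hl hc hf j with hm
    obtain ⟨w, hw, hweq⟩ := mem_image.1 (σ.eOrbOn hc hcl hP hL h12 hq m t).2
    rw [mem_filter] at hw
    have hwf : σ.onPoints w ≠ w := fun e => hw.2.2 ((Nondegenerate.eq_or_eq hw.2.1 (hL m.1 m.2.1) (hP w e) hcl).resolve_right m.2.2)
    have hum : σ.repF hc hL h12 hq hf s ≠ m.1 := fun e => hcs.2 (by rw [e, m.2.1])
    have hmeet : meetPt c (σ.repF hc hL h12 hq hf s) m.1 = c := (meetPt_eq c hum hcs.1 (hL m.1 m.2.1)).symm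
    change (((σ.eOrbOn hc hcl hP hL h12 hq m t).1 : Finset P).filter fun q => q ∈ σ.repF hc hL h12 hq hf s).card = 0
    rw [← hweq, σ.card_filter_orb3_on_fixedLine (c := c) m.2.1 hum hw.2.1, hmeet, if_neg (σ.not_mem_orb3_of_fixed hc hwf)]

end Data

end Flag

end Collineation

end Summit.Ventures.DiscreteObjects.PP12
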